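import Literature.NumberTheory.EllipticCurves.ManinConstantQuadraticTwistAtTwoOrdinaryProofs
import Literature.NumberTheory.EllipticCurves.MordellCurveTateAlgorithmTwoProofs
import HarnessLib

/-!
# Crux `ManinOddAtFour` (route `ManinLocalTwoThree`, cell `bsd-f2-manin`), line `dyadic-twist`, stub
# `stub_etaTwo` (E-an-1, Stevens' case `η = 2`), FILE 2: the NÉRON side K2 —
# «for `W` globally minimal, GOOD SUPERSINGULAR at `2` (`a₂(W)` even) and `d = ±2`, the twisted
# equation `W.quadraticTwist d = (0, d b₂/4, 0, 2 b₄, d b₆)` is GLOBALLY MINIMAL, `Δ = 2⁶ Δ(W)`»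

Helper file for the crux item stmt-BirchSwinnertonDyer-22967 (`--supports`), prover seat
`bsd-line-manin23-p3`. This is Connell's case «`p = 2`, `d ≡ 2 (mod 4)`, `v₂(c₆(E)) ≥ 3`» of
Pal 2012 Prop. 2.4 (`v₂(Δ′) = v₂(Δ) + 6`) = Stevens 1989 Lemma (5.2) with `η = 2`: the Néron lattice of
the twist is `s⁻¹ Λ(W)` with `s² = d`, i.e. `(2/g(χ)) Λ(W)` for `g(χ)² = 4d` — the factor `2` that the
newform side (FILE 1, `half_gaussSum_mul_mem_periodLattice_of_heckeTwo`) compensates.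

* `even_a₁_of_hasGoodReductionAtPrime_two_of_even_LFunction_two` — on a globally minimal equation
  with good reduction at `2`, `a₂(W)` even forces `a₁` even: if `ā₁ = 1` the reduction has the
  rational `2`-torsion point `(ā₃, ·)`, so `#W̃(𝔽₂)` is even and `a₂ = 3 − #W̃(𝔽₂)` is odd
  (Silverman *AEC* III.2.3, V.4: in characteristic `2`, ordinary `⟺ ā₁ ≠ 0`).
* `isGloballyMinimal_quadraticTwist_two_of_even_a₁` — for `a₁` even the tree's twisted equation
  `W.quadraticTwist d = (0, d b₂/4, 0, d² b₄/2, d³ b₆/4)` has INTEGER coefficients when `d = ±2`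
  (`4 ∣ b₂ = a₁² + 4a₂`), is minimal at odd places (unit twist,
  `isMinimalAt_quadraticTwist_intCast_of_odd_of_not_dvd`) and at `2` because
  `v₂(Δ) = v₂(d⁶ Δ(W)) = 6 < 12` (`isMinimal_of_exp_neg_twelve_lt_valued_Δ`).
Nothing about BSD is proved here.

References: [cite: Stevens1989, Lemma (5.2) p. 96] [cite: Pal2012, Prop. 2.4 (Connell), case p = 2, d ≡ 2 (mod 4)]
[cite: SilvermanAEC2009, III.2.3, V.4 (first paragraph), VII.1 Remark 1.1, Exercise 5.7]
-/

set_option autoImplicit false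
set_option linter.dupNamespace false

noncomputable section

open scoped Classical

open WeierstrassCurve IsDedekindDomain IsDedekindDomain.HeightOneSpectrum NumberField
  Rat.HeightOneSpectrum Literature.NumberTheory.EllipticCurves
  Literature.NumberTheory.GaloisRepresentations

namespace Summit.BirchSwinnertonDyer.BirchSwinnertonDyer.Theorems

/-! ## 1. Good reduction at `2` and `a₂` even ⟹ `a₁` even -/

section Parity

/-- Over `𝔽₂`, with `a₁ = 1`: the point `(a₃, a₃³ + a₂a₃² + a₄a₃ + a₆)` lies on the curve
(`y² + a₁xy + a₃y = y² = y` there). [elementary] -/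
private theorem twoTorsion_equation_aux :
    ∀ a₂ a₃ a₄ a₆ : ZMod 2,
      (a₃ ^ 3 + a₂ * a₃ ^ 2 + a₄ * a₃ + a₆) ^ 2 + 1 * a₃ * (a₃ ^ 3 + a₂ * a₃ ^ 2 + a₄ * a₃ + a₆) +
          a₃ * (a₃ ^ 3 + a₂ * a₃ ^ 2 + a₄ * a₃ + a₆) =
        a₃ ^ 3 + a₂ * a₃ ^ 2 + a₄ * a₃ + a₆ := by
  decide

/-- Over `𝔽₂`, with `a₁ = 1`, the point with `x = a₃` is its own negative. [elementary] -/
private theorem twoTorsion_negY_aux : ∀ a₃ y : ZMod 2, -y - 1 * a₃ - a₃ = y := by decide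

/-- **Over `𝔽₂`, an elliptic curve with `a₁ = 1` has an even number of points**: `(a₃, y₀)` with
`y₀ = a₃³ + a₂a₃² + a₄a₃ + a₆` is a rational point equal to its own negative
`(a₃, −y₀ − a₁a₃ − a₃)`, hence of order `2` (Silverman III.2.3; Cauchy).
[cite: SilvermanAEC2009, III.2.3 (group law) and V.4 (first paragraph)] -/
theorem even_natCard_point_of_a₁_eq_one (E : WeierstrassCurve (ZMod 2)) [E.IsElliptic]
    [Finite E.toAffine.Point] (h1 : E.a₁ = 1) : Even (Nat.card E.toAffine.Point) := by
  set y₀ : ZMod 2 := E.a₃ ^ 3 + E.a₂ * E.a₃ ^ 2 + E.a₄ * E.a₃ + E.a₆ with hy₀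
  have heq : E.toAffine.Equation E.a₃ y₀ := by
    rw [WeierstrassCurve.Affine.equation_iff]
    change y₀ ^ 2 + E.a₁ * E.a₃ * y₀ + E.a₃ * y₀ = E.a₃ ^ 3 + E.a₂ * E.a₃ ^ 2 + E.a₄ * E.a₃ + E.a₆
    rw [h1, hy₀]
    exact twoTorsion_equation_aux E.a₂ E.a₃ E.a₄ E.a₆
  have hns : E.toAffine.Nonsingular E.a₃ y₀ := (Affine.equation_iff_nonsingular).mp heq
  set P : E.toAffine.Point := Affine.Point.some E.a₃ y₀ hns with hP
  have hneg : -P = P := by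
    rw [hP, Affine.Point.neg_some, Affine.Point.some.injEq]
    refine ⟨rfl, ?_⟩
    change -y₀ - E.a₁ * E.a₃ - E.a₃ = y₀
    rw [h1]
    exact twoTorsion_negY_aux E.a₃ y₀
  have hP0 : P ≠ 0 := by
    rw [hP]
    exact Affine.Point.some_ne_zero hns
  have hord : addOrderOf P = 2 := by
    rw [addOrderOf_eq_prime_iff]
    refine ⟨?_, hP0⟩
    rw [two_nsmul]
    nth_rw 1 [← hneg]
    exact neg_add_cancel P
  have hdvd := addOrderOf_dvd_natCard P
  rw [hord] at hdvd
  exact even_iff_two_dvd.mpr hdvd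

variable (W : WeierstrassCurve ℚ) [W.IsElliptic] [W.IsGloballyMinimal]

omit [W.IsElliptic] in
/-- **Good reduction at `2` ⟹ the minimal discriminant is odd** (`v₂(Δ) = 0` for the globally
minimal equation; Silverman VII.5 Prop. 5.1(a)). [cite: SilvermanAEC2009, VII.5 Prop. 5.1] -/
theorem not_two_dvd_Δ_integralModelInt_of_hasGoodReductionAtPrime_two
    (hgood : W.HasGoodReductionAtPrime 2) : ¬ (2 : ℤ) ∣ (integralModelInt W).Δ := by
  obtain ⟨v, hv⟩ : ∃ v : HeightOneSpectrum (𝓞 ℚ), primesEquiv v = ⟨2, Nat.prime_two⟩ :=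
    ⟨(primesEquiv (R := 𝓞 ℚ)).symm ⟨2, Nat.prime_two⟩, Equiv.apply_symm_apply _ _⟩
  have hgen : natGenerator v = 2 := congrArg Subtype.val hv
  have hg := W.hasGoodReductionAtPrime_iff_hasGoodReductionAt_ringOfIntegers v
  rw [hv] at hg
  have hgv : W.HasGoodReductionAt v := hg.mp hgood
  have hΔ1 : v.valuation ℚ W.Δ = 1 :=
    (hasGoodReductionAt_iff_of_isMinimalAt (IsGloballyMinimal.isMinimal v)).mp hgv
  set M : WeierstrassCurve ℤ := integralModelInt W with hM
  have hWM : M.map (Int.castRingHom ℚ) = W := map_integralModelInt W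
  have hWΔ : W.Δ = (M.Δ : ℚ) := by rw [← hWM, map_Δ, eq_intCast]
  intro h2
  have hle := Rat.valuation_intCast_le v (n := M.Δ) (e := 1) (by rw [hgen, pow_one]; exact h2)
  rw [← hWΔ, hΔ1] at hle
  have hlt : WithZero.exp (-((1 : ℕ) : ℤ)) < (1 : WithZero (Multiplicative ℤ)) := by
    rw [← WithZero.exp_zero]; exact WithZero.exp_lt_exp.mpr (by norm_num)
  exact absurd hle (not_le.mpr hlt)

omit [W.IsElliptic] in
/-- **Good reduction at `2` and `a₁` odd ⟹ `#W̃(𝔽₂)` even** (the reduction is an elliptic curve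
over `𝔽₂` with `ā₁ = 1`, `even_natCard_point_of_a₁_eq_one`).
[cite: SilvermanAEC2009, V.4 (first paragraph) and III.2.3] -/
theorem even_reductionPointCount_two_of_odd_a₁ (hgood : W.HasGoodReductionAtPrime 2)
    (ha₁ : Odd (integralModelInt W).a₁) : Even (W.reductionPointCount 2) := by
  rw [WeierstrassCurve.reductionPointCount]
  set E : WeierstrassCurve (ZMod 2) := (integralModelInt W).map (Int.castRingHom (ZMod 2)) with hE
  have hΔ : E.Δ ≠ 0 := by
    rw [hE, map_Δ, eq_intCast, ne_eq, ZMod.intCast_zmod_eq_zero_iff_dvd]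
    exact_mod_cast not_two_dvd_Δ_integralModelInt_of_hasGoodReductionAtPrime_two W hgood
  haveI : E.IsElliptic := ⟨isUnit_iff_ne_zero.mpr hΔ⟩
  refine even_natCard_point_of_a₁_eq_one E ?_
  rw [hE, map_a₁, eq_intCast]
  obtain ⟨k, hk⟩ := ha₁
  rw [hk]
  push_cast
  rw [show (2 : ZMod 2) = 0 from rfl, zero_mul, zero_add]

/-- **Good reduction at `2` and `a₂(W) = (L(W, s))₂` even ⟹ `a₁` of the minimal equation is even**
(contrapositive: `a₁` odd ⟹ `#W̃(𝔽₂)` even ⟹ `a₂ = 3 − #W̃(𝔽₂)` odd; `W mod 2` supersingular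
`⟺ ā₁ = 0`, Silverman V.4). [cite: SilvermanAEC2009, V.4 (first paragraph), Exercises 5.7, 5.10(a), 8.19(a)] -/
theorem even_a₁_of_hasGoodReductionAtPrime_two_of_even_LFunction_two
    (hgood : W.HasGoodReductionAtPrime 2) (heven : Even (W.LFunction 2)) :
    Even (integralModelInt W).a₁ := by
  by_contra hodd
  rw [Int.not_even_iff_odd] at hodd
  obtain ⟨k, hk⟩ := even_reductionPointCount_two_of_odd_a₁ W hgood hodd
  have htr : Odd (W.frobeniusTrace 2) := by
    refine ⟨1 - k, ?_⟩
    rw [WeierstrassCurve.frobeniusTrace, hk]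
    push_cast
    ring
  rw [LFunction_apply_prime_eq_frobeniusTrace W 2 hgood] at heven
  exact (Int.not_odd_iff_even.mpr heven) htr

end Parity

/-! ## 2. K2: `W.quadraticTwist (±2)` is globally minimal for `W` good at `2` with `a₁` even -/

section MinimalTwist

variable (W : WeierstrassCurve ℚ) [W.IsGloballyMinimal]

/-- **The coefficients of `W.quadraticTwist d`, `d = ±2`, `a₁(W) = 2t`**: with `b′ = t² + a₂`
(`b₂ = 4b′`): `(0, d b′, 0, 2 b₄, d b₆)` — integers (Pal 2012 (2.2) at `d ≡ 2 (mod 4)` after the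
admissible rescaling `u = 2`). [cite: Pal2012, Prop. 2.4 (Connell), case p = 2] -/
theorem quadraticTwist_two_coeff {d : ℤ} (hd : d = 2 ∨ d = -2) {t : ℤ}
    (ht : (integralModelInt W).a₁ = t + t) :
    (W.quadraticTwist (d : ℚ)).a₁ = 0 ∧
    (W.quadraticTwist (d : ℚ)).a₂ = ((d * (t ^ 2 + (integralModelInt W).a₂) : ℤ) : ℚ) ∧
    (W.quadraticTwist (d : ℚ)).a₃ = 0 ∧
    (W.quadraticTwist (d : ℚ)).a₄ = ((2 * (integralModelInt W).b₄ : ℤ) : ℚ) ∧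
    (W.quadraticTwist (d : ℚ)).a₆ = ((d * (integralModelInt W).b₆ : ℤ) : ℚ) := by
  set M : WeierstrassCurve ℤ := integralModelInt W with hM
  have hWM : M.map (Int.castRingHom ℚ) = W := map_integralModelInt W
  have hb₂ : W.b₂ = (M.b₂ : ℚ) := by rw [← hWM, map_b₂, eq_intCast]
  have hb₄ : W.b₄ = (M.b₄ : ℚ) := by rw [← hWM, map_b₄, eq_intCast]
  have hb₆ : W.b₆ = (M.b₆ : ℚ) := by rw [← hWM, map_b₆, eq_intCast]
  have hMb₂ : M.b₂ = 4 * (t ^ 2 + M.a₂) := by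
    rw [WeierstrassCurve.b₂, ht]; ring
  have hd2 : (d : ℚ) ^ 2 = 4 := by rcases hd with rfl | rfl <;> norm_num
  have hd3 : (d : ℚ) ^ 3 = 4 * d := by
    rw [pow_succ, hd2]
  refine ⟨quadraticTwist_a₁ W _, ?_, quadraticTwist_a₃ W _, ?_, ?_⟩
  · rw [quadraticTwist_a₂, hb₂, hMb₂]; push_cast; ring
  · rw [quadraticTwist_a₄, hb₄, hd2]; push_cast; ring
  · rw [quadraticTwist_a₆, hb₆, hd3]; push_cast; ring

/-- For `d = ±2` and an odd prime place `v`, `p_v ∤ d`. [elementary] -/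
theorem not_natCast_dvd_of_ne_two {d : ℤ} (hd : d = 2 ∨ d = -2) (v : HeightOneSpectrum (𝓞 ℚ))
    (hv2 : (primesEquiv v : ℕ) ≠ 2) : ¬ ((primesEquiv v : ℕ) : ℤ) ∣ d := by
  have hℓp : (primesEquiv v : ℕ).Prime := (primesEquiv v).2
  have hℓ2 : ¬ ((primesEquiv v : ℕ) : ℤ) ∣ 2 := fun h ↦
    hv2 ((Nat.prime_dvd_prime_iff_eq hℓp Nat.prime_two).mp (Int.natCast_dvd_natCast.mp h))
  rcases hd with rfl | rfl
  · exact hℓ2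
  · exact fun h ↦ hℓ2 (dvd_neg.mp h)

/-- **K2 — `W.quadraticTwist (±2)` is GLOBALLY MINIMAL for `W` globally minimal, GOOD at `2` with
`a₁` even (supersingular at `2`)**: the equation `(0, d b′, 0, 2 b₄, d b₆)` is integral, minimal at
odd places (twist by the `v`-unit `d`, `isMinimalAt_quadraticTwist_intCast_of_odd_of_not_dvd`), and
minimal at `2` since `Δ = d⁶ Δ(W)` has `v₂ = 6 < 12` (`isMinimal_of_exp_neg_twelve_lt_valued_Δ`).
This is Stevens' Lemma (5.2) in the case `η = 2` (Connell / Pal 2012 Prop. 2.4, `p = 2`,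
`d ≡ 2 (mod 4)`, `v₂(c₆(E)) ≥ 3`: `v₂(Δ′) = v₂(Δ) + 6`). [cite: Stevens1989, Lemma (5.2) p. 96]
[cite: Pal2012, Prop. 2.4 (Connell), case p = 2] [cite: SilvermanAEC2009, VII.1 Remark 1.1] -/
theorem isGloballyMinimal_quadraticTwist_two_of_even_a₁ {d : ℤ} (hd : d = 2 ∨ d = -2)
    (hgood : W.HasGoodReductionAtPrime 2) (ha₁ : Even (integralModelInt W).a₁) :
    (W.quadraticTwist (d : ℚ)).IsGloballyMinimal := by
  obtain ⟨t, ht⟩ := ha₁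
  obtain ⟨h1, h2, h3, h4, h6⟩ := quadraticTwist_two_coeff W hd ht
  set M : WeierstrassCurve ℤ := integralModelInt W with hM
  set T : WeierstrassCurve ℚ := W.quadraticTwist (d : ℚ) with hT
  have hdZ : d ≠ 0 := by rcases hd with rfl | rfl <;> norm_num
  -- integrality at every place
  have hint : ∀ v : HeightOneSpectrum (𝓞 ℚ), T.IsIntegralAt v := by
    intro v
    refine T.isIntegralAt_of_valuation_le_one v ?_ ?_ ?_ ?_ ?_
    · rw [h1, map_zero]; exact zero_le_one
    · rw [h2]; exact valuation_ringOfIntegers_intCast_le_one v _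
    · rw [h3, map_zero]; exact zero_le_one
    · rw [h4]; exact valuation_ringOfIntegers_intCast_le_one v _
    · rw [h6]; exact valuation_ringOfIntegers_intCast_le_one v _
  refine ⟨?_, fun v ↦ ?_⟩
  · -- integral over `𝓞 ℚ`
    refine ⟨⟨⟨0, ((d * (t ^ 2 + M.a₂) : ℤ) : 𝓞 ℚ), 0, ((2 * M.b₄ : ℤ) : 𝓞 ℚ),
      ((d * M.b₆ : ℤ) : 𝓞 ℚ)⟩, ?_⟩⟩
    ext
    · simpa [WeierstrassCurve.baseChange] using h1
    · simp only [WeierstrassCurve.baseChange, map_a₂, map_intCast]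
      exact h2
    · simpa [WeierstrassCurve.baseChange] using h3
    · simp only [WeierstrassCurve.baseChange, map_a₄, map_intCast]
      exact h4
    · simp only [WeierstrassCurve.baseChange, map_a₆, map_intCast]
      exact h6
  by_cases hv : (primesEquiv v : ℕ) = 2
  · -- the place over `2`: `v(Δ_T) = v(d)⁶ · v(Δ_W) = exp(-6) > exp(-12)`
    haveI : (T.baseChange (v.adicCompletion ℚ)).IsIntegral (v.adicCompletionIntegers ℚ) := hint v
    have hgen : natGenerator v = 2 := hv
    have hWM : M.map (Int.castRingHom ℚ) = W := map_integralModelInt W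
    have hg := W.hasGoodReductionAtPrime_iff_hasGoodReductionAt_ringOfIntegers v
    have hv' : primesEquiv v = ⟨2, Nat.prime_two⟩ := Subtype.ext hv
    rw [hv'] at hg
    have hΔ1 : v.valuation ℚ W.Δ = 1 :=
      (hasGoodReductionAt_iff_of_isMinimalAt (IsGloballyMinimal.isMinimal v)).mp (hg.mp hgood)
    have hvd : v.valuation ℚ (d : ℚ) = WithZero.exp (-1 : ℤ) := by
      have hv2 := Rat.valuation_natGenerator v
      rw [hgen, Nat.cast_ofNat] at hv2
      rcases hd with rfl | rfl
      · exact_mod_cast hv2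
      · rw [Int.cast_neg, Valuation.map_neg]; exact_mod_cast hv2
    refine isMinimal_of_exp_neg_twelve_lt_valued_Δ v _ ?_
    rw [show (T.baseChange (v.adicCompletion ℚ)).Δ = algebraMap ℚ (v.adicCompletion ℚ) T.Δ by
      rw [WeierstrassCurve.baseChange, map_Δ], WeierstrassCurve.valued_algebraMap_adicCompletion, hT,
      quadraticTwist_Δ,
      Valuation.map_mul, Valuation.map_pow, hvd, hΔ1, mul_one, ← WithZero.exp_nsmul]
    exact WithZero.exp_lt_exp.mpr (by norm_num)
  · exact isMinimalAt_quadraticTwist_intCast_of_odd_of_not_dvd W v hv (not_natCast_dvd_of_ne_two hd v hv)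

variable [W.IsElliptic]

/-- **K2 with the parity input**: `W` globally minimal, good at `2`, `a₂(W)` even, `d = ±2` ⟹
`W.quadraticTwist d` is globally minimal. [cite: Stevens1989, Lemma (5.2) p. 96]
[cite: Pal2012, Prop. 2.4 (Connell), case p = 2] -/
theorem isGloballyMinimal_quadraticTwist_two_of_even_LFunction_two {d : ℤ} (hd : d = 2 ∨ d = -2)
    (hgood : W.HasGoodReductionAtPrime 2) (hss : Even (W.LFunction 2)) :
    (W.quadraticTwist (d : ℚ)).IsGloballyMinimal :=
  isGloballyMinimal_quadraticTwist_two_of_even_a₁ W hd hgood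
    (even_a₁_of_hasGoodReductionAtPrime_two_of_even_LFunction_two W hgood hss)

end MinimalTwist

end Summit.BirchSwinnertonDyer.BirchSwinnertonDyer.Theorems

end
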